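import Summits.QuantumFields.YangMills.Theorems.UnitScaleTiltHistoryTailOneSupplierFL
import HarnessLib

/-!
# `UnitScaleTiltHistoryTailOneSupplierSplit` — THE TWO-SUPPLIER SPLIT OF THE ONE-SUPPLIER THEOREM: `HistoryTailL` ⇐ ⟨T8 text⟩ ∧ a PER-RECORD KINEMATIC (FL) THEOREM ∧ the
# (O″χ) χ DATA ROWS ALONE — so that the (FL) team's end theorem (★w1 LEAD ∕ ★w2 ∕ ★w3 ∕ ★w4 ∕ ★alpha-2, OWNER RULING g24-№4) has a by-name target mentioning NO profile
# thresholds and NO data rows, and ★alpha-1's (NODE O) one mentioning NO lift — cell `ym3-torus`, route `UnitScaleTilt`, crux stmt-QuantumFields-19936 (v5p9, 2′χ), width seat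
# `ym-ust-19936-w5` (g0); third file of the `…HistoryTailOneSupplier` group (p590846, p591256)

WHY.  In `…HistoryTailOneSupplier(FL)` the supplier rows `hrows` bundle, per exhibited record, the (FL) row and the (O″χ) row; but they come from DIFFERENT seats with different
freedoms: the (O″χ) supplier must CHOOSE the record (its seed carries the cluster expansion's true constants; only the profile, `B₃ := B`, `C68` and `M₁` are dictated), whereas a
KINEMATIC (FL) theorem holds for EVERY record above a floor `B_FL ≤ B₃`, given only the smallness of the windows `B₃·ε_W(k)` — which the exhibited record's rows provide
k-uniformly (`1 ≤ 2B₃`, the two small-`a₁` rows at `(B₃, a₁)`, the three `C68`-rows at `a₁`, `7L + 3 ≤ M₁`; cf. `MinimiserPin.small_of_C68` ∕ `anti_of_C68` ∕ `C68_dom_of_le` as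
used in `…v3RecordFL.innerExactLiftT3_of_fineLifts_of_sizes`), with its own ceiling `a₁ ≤ A_FL` if it wants the windows smaller still.  THIS FILE performs the split:
* §1 ★★ `pinnedPartsT3ACRecFLChi_of_thm1_fineLifts_dataRows` — (T) at any constants + `hFL` «∃ floor `B_FL`, ceiling `A_FL > 0`: for EVERY record `𝔠` with `B_FL ≤ 𝔠.B₃` and every
  `0 < a₁ ≤ A_FL` satisfying the record rows above, (FL) `InnerFineLiftsT3 F (hF ▸ 𝔠) γ hγ hγ1 K 𝔠.B₃` for every family of block size `L`, coupling of the window and run» + `hO`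
  = `hrows` of `pinnedPartsT3ACRecFLChi_of_thm1_rows` with the (FL) conjunct DELETED ⇒ `PinnedPartsT3ACRecFLChi L` (floor `max B₀ B_FL`, ceiling `min A₁ A_FL`);
  ★★ `pinnedPartsT3ACRecFLChi_of_thm1_regionalLifts_dataRows` — the same with (FL) in RULING №4's currency: ★w1's `hLift` binder at a kinematic constant `B_L ≥ 1` for every record
  with `B_L·L² ≤ 𝔠.B₃` (`…OneSupplierFL.innerFineLiftsT3_of_regionalLifts_le`).
* §2 ★★★ `historyTailL_of_thm1In8_fineLifts_dataRows_allL` ∕ `historyTailL_of_thm1In8_regionalLifts_dataRows_allL` — `HistoryTailL` ⇐ ⟨v5kC's T8 text⟩ ∧ (∀ odd `L > 1`, the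
  kinematic (FL) theorem) ∧ (∀ odd `L > 1`, the (O″χ) rows in `hrows`-shape) — stmt-QuantumFields-19936 BY NAME from three independently owned deliverables.
HONEST FRAMING.  Restriction of quantifiers over the two companion files; every hypothesis (T8, the kinematic (FL) theorem, the χ data rows) is analytic content NOT proved here;
def-free; count-neutral helper (`--supports stmt-QuantumFields-19936`); registry untouched.  YM₃ on the three-torus is rung R3 of the programme, NOT the Clay problem: nothing
here bears on d = 4, infinite volume, or a mass gap.

References: T. Bałaban, Commun. Math. Phys. 102 (1985) 277–309 [Balaban1985Variational] (Thm 1 (6)–(8) pp.278–279, (11)–(14) pp.279–280, Prop 8 p.304); Commun. Math. Phys.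
102 (1985) 255–275 [Balaban1985UV3] ((5) p.256, (7) p.257, (40)–(42) p.266, (47) p.267, (68) p.273, (71) p.273, Thm 2 p.272); C. King, Commun. Math. Phys. 102 (1986) 649–677
[King1986] ((3.12) p.657).
-/

set_option autoImplicit false

noncomputable section

namespace Summit.QuantumFields.YangMills.Theorems.HistoryTailOneSupplier

open MeasureTheory Set
open scoped Matrix.Norms.L2Operator
open Literature.MathematicalPhysics.QuantumFieldTheory.Balaban1983to89
open Literature.MathematicalPhysics.QuantumFieldTheory.Balaban1983to89.T3ContinuumYM3Torus
open Literature.MathematicalPhysics.QuantumFieldTheory.Balaban1983to89.T3UnitLawDensityEML (ℰp)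
open Literature.MathematicalPhysics.QuantumFieldTheory.Balaban1983to89.T3UnitScaleTilt (θBal)
open Literature.MathematicalPhysics.QuantumFieldTheory.Balaban1983to89.T3PrintedMinimiserExistence (Thm1GlobalMinAt)
open Literature.MathematicalPhysics.QuantumFieldTheory.Balaban1983to89.T3LowerAlongMinimisersSplit (MinimisersIn8At)
open Literature.MathematicalPhysics.QuantumFieldTheory.Balaban1983to89.ExpMeanLog (deltaSU deltaSU_pos)
open Literature.MathematicalPhysics.QuantumFieldTheory.Balaban1983to89.B10Eq38TorusDomains (plaqsIn)
open Literature.MathematicalPhysics.QuantumFieldTheory.Balaban1983to89.B10Eq42TorusConstraint (bondsIn)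
open Literature.MathematicalPhysics.QuantumFieldTheory.Balaban1985CMP102.Setting
open Summit.QuantumFields.Balaban3D.Carriers
open Summit.QuantumFields.Balaban3D.Proofs.Primitives
open Summit.QuantumFields.Balaban3D.Proofs.Thresholds (Q0 Q0_pos)
open B7Prop2Explicit (C0 C0_pos)

/-! ## §1 The display from (T), a PER-RECORD kinematic (FL) theorem, and the (O″χ) rows alone -/

/-- ★★ **THE 2′χ DISPLAY FROM (T) AT ANY CONSTANTS, A PER-RECORD KINEMATIC (FL) THEOREM AND THE (O″χ) ROWS ALONE.**  `hFL`: for every record with `B_FL ≤ B₃` and every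
`0 < a₁ ≤ A_FL` satisfying `1 ≤ 2B₃`, the two small-`a₁` rows, the three `C68`-rows and `7L + 3 ≤ M₁` (the k-uniform window smallness lives in these), (FL) at `B₃` for every family,
coupling and run; `hO`: the (O″χ) rows in `hrows`-shape (the data supplier exhibits the record).  Then `PinnedPartsT3ACRecFLChi L` (`pinnedPartsT3ACRecFLChi_of_thm1_rows` at floor
`max B₀ B_FL`, ceiling `min A₁ A_FL`). [cite: Balaban1985Variational, Thm 1 (6)–(8) pp.278–279; Balaban1985UV3, (7) p.257, (40)–(42) p.266, (47) p.267, (68) p.273 and Thm 2 p.272] -/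
theorem pinnedPartsT3ACRecFLChi_of_thm1_fineLifts_dataRows {L : ℕ} (hL : 1 < L)
    (hT : ∃ a₀ a₁ B₃ : ℝ, 0 < a₀ ∧ 0 < a₁ ∧ 0 < B₃ ∧ Thm1GlobalMinAt L a₀ a₁ B₃)
    {B_FL A_FL : ℝ} (hA_FL : 0 < A_FL)
    (hFL : ∀ (𝔠 : AlphaConsts L (suGroupModel 2).N) (a₁ : ℝ), B_FL ≤ 𝔠.B₃ → 1 ≤ 2 * 𝔠.B₃ → 0 < a₁ → a₁ ≤ A_FL →
      (143 * ((((3 + 4 : ℕ) : ℝ)) ^ 2 / 4) ^ 2) * (2 * (𝔠.B₃ * a₁)) ≤ 1 / 3 →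
      2 * (2 * (𝔠.B₃ * a₁)) ≤ 2 * deltaSU (Fin 2) / (((3 + 4) * L : ℕ) : ℝ) ^ 2 →
      4 * 𝔠.B₃ * (L : ℝ) ^ 2 * avgWindowFactor L ≤ 𝔠.C68 →
      Real.exp (𝔠.p₀ - 1) ≤ 3 * C0 3 * 𝔠.C68 * (𝔠.b₀ * Q0 𝔠.p₀) →
      (𝔠.b₀ * Q0 𝔠.p₀) * (2 * (L : ℝ) ^ 2 * avgWindowFactor L) ^ 2 ≤ 3 * C0 3 * 𝔠.C68 * a₁ ^ 2 →
      7 * L + 3 ≤ 𝔠.M₁ →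
      ∀ (F : T3Family) (hF : F.L = L) (γ : ℝ) (hγ : 0 < γ) (hγ1 : γ ≤ (min (hF ▸ 𝔠).gamma0 1) ^ 2) (K : ℕ),
        AlphaInputsT3AC.InnerFineLiftsT3 F (hF ▸ 𝔠) γ hγ hγ1 K (hF ▸ 𝔠).B₃)
    {B₀ A₀ A₁ : ℝ} (hA₀ : 0 < A₀) (hA₁ : 0 < A₁)
    (hO : ∀ (B a₀ a₁ : ℝ), B₀ ≤ B → 1 ≤ 2 * B → 0 < a₀ → a₀ ≤ A₀ → 0 < a₁ → a₁ ≤ A₁ → B * a₁ ≤ a₀ →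
        (143 * ((((3 + 4 : ℕ) : ℝ)) ^ 2 / 4) ^ 2) * (2 * (B * a₁)) ≤ 1 / 3 →
        2 * (2 * (B * a₁)) ≤ 2 * deltaSU (Fin 2) / (((3 + 4) * L : ℕ) : ℝ) ^ 2 →
        Thm1GlobalMinAt L a₀ a₁ B →
        ∃ (b₁ p₁ : ℝ), ∀ (b₀ p₀ : ℝ), b₁ ≤ b₀ → p₁ ≤ p₀ →
          ∃ 𝔠 : AlphaConsts L (suGroupModel 2).N, 𝔠.b₀ = b₀ ∧ 𝔠.p₀ = p₀ ∧ 𝔠.B₃ = B ∧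
            4 * 𝔠.B₃ * (L : ℝ) ^ 2 * avgWindowFactor L ≤ 𝔠.C68 ∧
            Real.exp (𝔠.p₀ - 1) ≤ 3 * C0 3 * 𝔠.C68 * (𝔠.b₀ * Q0 𝔠.p₀) ∧
            (𝔠.b₀ * Q0 𝔠.p₀) * (2 * (L : ℝ) ^ 2 * avgWindowFactor L) ^ 2 ≤ 3 * C0 3 * 𝔠.C68 * a₁ ^ 2 ∧
            7 * L + 3 ≤ 𝔠.M₁ ∧
            ∀ (F : T3Family) (hF : F.L = L),
              (∀ (γ : ℝ) (hγ : 0 < γ) (hγ1 : γ ≤ (min (hF ▸ 𝔠).gamma0 1) ^ 2) (K : ℕ),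
                (∃ Ut : (k : ℕ) → GaugeField (F.P K) k (Matrix.specialUnitaryGroup (Fin 2) ℂ) →
                    GaugeField (F.P K) 0 (Matrix.specialUnitaryGroup (Fin 2) ℂ),
                  AlphaInputsT3AC.TrivMinimiserRowsT3 F (hF ▸ 𝔠) γ hγ hγ1 a₀ a₁ K Ut) →
                ∃ Ut : (k : ℕ) → GaugeField (F.P K) k (Matrix.specialUnitaryGroup (Fin 2) ℂ) →
                    GaugeField (F.P K) 0 (Matrix.specialUnitaryGroup (Fin 2) ℂ),
                  AlphaInputsT3AC.TrivMinimiserRowsT3 F (hF ▸ 𝔠) γ hγ hγ1 a₀ a₁ K Ut ∧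
                    AlphaInputsT3AC.DataRowsT3XChi F (hF ▸ 𝔠) γ hγ hγ1 K Ut)) :
    AlphaInputsT3AC.PinnedPartsT3ACRecFLChi L := by
  refine pinnedPartsT3ACRecFLChi_of_thm1_rows hL hT hA₀ (lt_min hA₁ hA_FL) (B₀ := max B₀ B_FL)
    fun B a₀ a₁ h1 h2 h3 h4 h5 h6 h7 h8 h9 h10 => ?_
  obtain ⟨b₁, p₁, hrec⟩ := hO B a₀ a₁ ((le_max_left _ _).trans h1) h2 h3 h4 h5 (h6.trans (min_le_left _ _)) h7 h8 h9 h10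
  refine ⟨b₁, p₁, fun b₀ p₀ hb hp => ?_⟩
  obtain ⟨𝔠, e1, e2, e3, s1, s2, s3, s4, hOF⟩ := hrec b₀ p₀ hb hp
  refine ⟨𝔠, e1, e2, e3, s1, s2, s3, s4, fun F hF => ⟨fun γ hγ hγ1 K => ?_, hOF F hF⟩⟩
  have hBc : B_FL ≤ 𝔠.B₃ := by rw [e3]; exact (le_max_right _ _).trans h1
  exact hFL 𝔠 a₁ hBc (by rw [e3]; exact h2) h5 (h6.trans (min_le_right _ _)) (by rw [e3]; exact h8) (by rw [e3]; exact h9)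
    s1 s2 s3 s4 F hF γ hγ hγ1 K

/-- ★★ **THE SAME WITH (FL) IN THE CURRENCY OF RECORD**: ★w1's `hLift` binder (exact `k`-fold lifts of every windowed level-`k` datum on `bondsIn k Ω_{k+1}(h)` with finest
plaquettes `< B_L·ε_W(k+1)·L^{−2k}`) at ONE kinematic constant `B_L ≥ 1`, for every record with `B_L·L² ≤ B₃` and the record rows — through
`innerFineLiftsT3_of_regionalLifts_le`. [cite: Balaban1985Variational, Thm 1 (8) p.279, (11)–(14) pp.279–280; Balaban1985UV3, (7) p.257, (40)–(42) p.266, (47) p.267 and Thm 2 p.272] -/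
theorem pinnedPartsT3ACRecFLChi_of_thm1_regionalLifts_dataRows {L : ℕ} (hL : 1 < L)
    (hT : ∃ a₀ a₁ B₃ : ℝ, 0 < a₀ ∧ 0 < a₁ ∧ 0 < B₃ ∧ Thm1GlobalMinAt L a₀ a₁ B₃)
    {B_L A_FL : ℝ} (hBL : 1 ≤ B_L) (hA_FL : 0 < A_FL)
    (hLift : ∀ (𝔠 : AlphaConsts L (suGroupModel 2).N) (a₁ : ℝ), B_L * (L : ℝ) ^ 2 ≤ 𝔠.B₃ → 1 ≤ 2 * 𝔠.B₃ → 0 < a₁ → a₁ ≤ A_FL →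
      (143 * ((((3 + 4 : ℕ) : ℝ)) ^ 2 / 4) ^ 2) * (2 * (𝔠.B₃ * a₁)) ≤ 1 / 3 →
      2 * (2 * (𝔠.B₃ * a₁)) ≤ 2 * deltaSU (Fin 2) / (((3 + 4) * L : ℕ) : ℝ) ^ 2 →
      4 * 𝔠.B₃ * (L : ℝ) ^ 2 * avgWindowFactor L ≤ 𝔠.C68 →
      Real.exp (𝔠.p₀ - 1) ≤ 3 * C0 3 * 𝔠.C68 * (𝔠.b₀ * Q0 𝔠.p₀) →
      (𝔠.b₀ * Q0 𝔠.p₀) * (2 * (L : ℝ) ^ 2 * avgWindowFactor L) ^ 2 ≤ 3 * C0 3 * 𝔠.C68 * a₁ ^ 2 →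
      7 * L + 3 ≤ 𝔠.M₁ →
      ∀ (F : T3Family) (hF : F.L = L) (γ : ℝ) (hγ : 0 < γ) (hγ1 : γ ≤ (min (hF ▸ 𝔠).gamma0 1) ^ 2) (K : ℕ),
        ∀ (k : ℕ), k + 1 ≤ K → ∀ (h : Hist (F.P K) (k + 1)),
                  Hist.Admissible (hF ▸ 𝔠).lane.carrier.M₁ (rcolOf (T3Scales F γ hγ (hγ1.trans (sq_min_one_le _ (hF ▸ 𝔠).gamma0_pos)) K) (hF ▸ 𝔠).lane.carrier) (k + 1) h →
                  h ≠ Hist.triv (F.P K) (k + 1) → ∀ (V : GaugeField (F.P K) k (Matrix.specialUnitaryGroup (Fin 2) ℂ)),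
                    (∀ Q : Plaq (F.P K) k, Q ∈ plaqsIn k (Omega (hF ▸ 𝔠).lane.carrier.M₁
                        (rcolOf (T3Scales F γ hγ (hγ1.trans (sq_min_one_le _ (hF ▸ 𝔠).gamma0_pos)) K) (hF ▸ 𝔠).lane.carrier) (k + 1) h (k + 1)) →
                      GaugeGroup.dist1 (GaugeField.plaqHol V Q) ≤ 2 * (F.L : ℝ) ^ 2 * avgWindowFactor F.L * θBal F.L γ (hF ▸ 𝔠).b₀ (hF ▸ 𝔠).p₀ (K - k)) →
                    ∃ U : GaugeField (F.P K) 0 (Matrix.specialUnitaryGroup (Fin 2) ℂ),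
                      (∀ b : PBond (F.P K) k, b ∈ bondsIn k (Omega (hF ▸ 𝔠).lane.carrier.M₁
                          (rcolOf (T3Scales F γ hγ (hγ1.trans (sq_min_one_le _ (hF ▸ 𝔠).gamma0_pos)) K) (hF ▸ 𝔠).lane.carrier) (k + 1) h (k + 1)) →
                        Averaging.iter (fun i => BlockAveraging.blockAvg (P := F.P K) (j := i) ℰp) k U b = V b) ∧
                      ∀ q : Plaq (F.P K) 0, q ∈ plaqsIn 0 (Omega (hF ▸ 𝔠).lane.carrier.M₁
                          (rcolOf (T3Scales F γ hγ (hγ1.trans (sq_min_one_le _ (hF ▸ 𝔠).gamma0_pos)) K) (hF ▸ 𝔠).lane.carrier) (k + 1) h (k + 1)) →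
                        GaugeGroup.dist1 (GaugeField.plaqHol U q) <
                          B_L * (2 * (F.L : ℝ) ^ 2 * avgWindowFactor F.L * θBal F.L γ (hF ▸ 𝔠).b₀ (hF ▸ 𝔠).p₀ (K - k)) * (((F.L : ℝ) ^ k)⁻¹) ^ 2)
    {B₀ A₀ A₁ : ℝ} (hA₀ : 0 < A₀) (hA₁ : 0 < A₁)
    (hO : ∀ (B a₀ a₁ : ℝ), B₀ ≤ B → 1 ≤ 2 * B → 0 < a₀ → a₀ ≤ A₀ → 0 < a₁ → a₁ ≤ A₁ → B * a₁ ≤ a₀ →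
        (143 * ((((3 + 4 : ℕ) : ℝ)) ^ 2 / 4) ^ 2) * (2 * (B * a₁)) ≤ 1 / 3 →
        2 * (2 * (B * a₁)) ≤ 2 * deltaSU (Fin 2) / (((3 + 4) * L : ℕ) : ℝ) ^ 2 →
        Thm1GlobalMinAt L a₀ a₁ B →
        ∃ (b₁ p₁ : ℝ), ∀ (b₀ p₀ : ℝ), b₁ ≤ b₀ → p₁ ≤ p₀ →
          ∃ 𝔠 : AlphaConsts L (suGroupModel 2).N, 𝔠.b₀ = b₀ ∧ 𝔠.p₀ = p₀ ∧ 𝔠.B₃ = B ∧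
            4 * 𝔠.B₃ * (L : ℝ) ^ 2 * avgWindowFactor L ≤ 𝔠.C68 ∧
            Real.exp (𝔠.p₀ - 1) ≤ 3 * C0 3 * 𝔠.C68 * (𝔠.b₀ * Q0 𝔠.p₀) ∧
            (𝔠.b₀ * Q0 𝔠.p₀) * (2 * (L : ℝ) ^ 2 * avgWindowFactor L) ^ 2 ≤ 3 * C0 3 * 𝔠.C68 * a₁ ^ 2 ∧
            7 * L + 3 ≤ 𝔠.M₁ ∧
            ∀ (F : T3Family) (hF : F.L = L),
              (∀ (γ : ℝ) (hγ : 0 < γ) (hγ1 : γ ≤ (min (hF ▸ 𝔠).gamma0 1) ^ 2) (K : ℕ),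
                (∃ Ut : (k : ℕ) → GaugeField (F.P K) k (Matrix.specialUnitaryGroup (Fin 2) ℂ) →
                    GaugeField (F.P K) 0 (Matrix.specialUnitaryGroup (Fin 2) ℂ),
                  AlphaInputsT3AC.TrivMinimiserRowsT3 F (hF ▸ 𝔠) γ hγ hγ1 a₀ a₁ K Ut) →
                ∃ Ut : (k : ℕ) → GaugeField (F.P K) k (Matrix.specialUnitaryGroup (Fin 2) ℂ) →
                    GaugeField (F.P K) 0 (Matrix.specialUnitaryGroup (Fin 2) ℂ),
                  AlphaInputsT3AC.TrivMinimiserRowsT3 F (hF ▸ 𝔠) γ hγ hγ1 a₀ a₁ K Ut ∧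
                    AlphaInputsT3AC.DataRowsT3XChi F (hF ▸ 𝔠) γ hγ hγ1 K Ut)) :
    AlphaInputsT3AC.PinnedPartsT3ACRecFLChi L := by
  refine pinnedPartsT3ACRecFLChi_of_thm1_fineLifts_dataRows hL hT (B_FL := B_L * (L : ℝ) ^ 2) hA_FL
    (fun 𝔠 a₁ hB h2 h5 h6 h8 h9 s1 s2 s3 s4 F hF γ hγ hγ1 K => ?_) hA₀ hA₁ hO
  have hl := hLift 𝔠 a₁ hB h2 h5 h6 h8 h9 s1 s2 s3 s4 F hF γ hγ hγ1 K
  subst hF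
  exact innerFineLiftsT3_of_regionalLifts_le hBL hB hl


/-! ## §2 The crux from T8's text, a per-record kinematic (FL) theorem at every odd `L`, and the (O″χ) rows -/

/-- ★★★ **`HistoryTailL` ⇐ ⟨v5kC's T8 TEXT⟩ ∧ (∀ odd `L > 1`, A PER-RECORD KINEMATIC (FL) THEOREM) ∧ (∀ odd `L > 1`, THE (O″χ) ROWS)** — stmt-QuantumFields-19936 by name from
three independently owned deliverables (19200's line; the (FL) team's kinematic theorem; NODE O's χ data rows for its own records).
[cite: Balaban1985UV3, (5) p.256, (47) p.267, (71) p.273 and Thm 2 p.272; Balaban1985Variational, Thm 1 (8) p.279 and Prop 8 p.304; King1986, (3.12) p.657] -/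
theorem historyTailL_of_thm1In8_fineLifts_dataRows_allL
    (hT8 : ∀ L : ℕ, Odd L → 1 < L → ∃ a₀ a₁ B₃ : ℝ, 0 < a₀ ∧ 0 < a₁ ∧ 0 < B₃ ∧
      Thm1GlobalMinAt L a₀ a₁ B₃ ∧ MinimisersIn8At L a₀ a₁ B₃)
    (hFL : ∀ L : ℕ, Odd L → 1 < L → ∃ (B_FL A_FL : ℝ), 0 < A_FL ∧
      ∀ (𝔠 : AlphaConsts L (suGroupModel 2).N) (a₁ : ℝ), B_FL ≤ 𝔠.B₃ → 1 ≤ 2 * 𝔠.B₃ → 0 < a₁ → a₁ ≤ A_FL →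
      (143 * ((((3 + 4 : ℕ) : ℝ)) ^ 2 / 4) ^ 2) * (2 * (𝔠.B₃ * a₁)) ≤ 1 / 3 →
      2 * (2 * (𝔠.B₃ * a₁)) ≤ 2 * deltaSU (Fin 2) / (((3 + 4) * L : ℕ) : ℝ) ^ 2 →
      4 * 𝔠.B₃ * (L : ℝ) ^ 2 * avgWindowFactor L ≤ 𝔠.C68 →
      Real.exp (𝔠.p₀ - 1) ≤ 3 * C0 3 * 𝔠.C68 * (𝔠.b₀ * Q0 𝔠.p₀) →
      (𝔠.b₀ * Q0 𝔠.p₀) * (2 * (L : ℝ) ^ 2 * avgWindowFactor L) ^ 2 ≤ 3 * C0 3 * 𝔠.C68 * a₁ ^ 2 →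
      7 * L + 3 ≤ 𝔠.M₁ →
      ∀ (F : T3Family) (hF : F.L = L) (γ : ℝ) (hγ : 0 < γ) (hγ1 : γ ≤ (min (hF ▸ 𝔠).gamma0 1) ^ 2) (K : ℕ),
        AlphaInputsT3AC.InnerFineLiftsT3 F (hF ▸ 𝔠) γ hγ hγ1 K (hF ▸ 𝔠).B₃)
    (hO : ∀ L : ℕ, Odd L → 1 < L → ∃ (B₀ A₀ A₁ : ℝ), 0 < A₀ ∧ 0 < A₁ ∧
      ∀ (B a₀ a₁ : ℝ), B₀ ≤ B → 1 ≤ 2 * B → 0 < a₀ → a₀ ≤ A₀ → 0 < a₁ → a₁ ≤ A₁ → B * a₁ ≤ a₀ →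
        (143 * ((((3 + 4 : ℕ) : ℝ)) ^ 2 / 4) ^ 2) * (2 * (B * a₁)) ≤ 1 / 3 →
        2 * (2 * (B * a₁)) ≤ 2 * deltaSU (Fin 2) / (((3 + 4) * L : ℕ) : ℝ) ^ 2 →
        Thm1GlobalMinAt L a₀ a₁ B →
        ∃ (b₁ p₁ : ℝ), ∀ (b₀ p₀ : ℝ), b₁ ≤ b₀ → p₁ ≤ p₀ →
          ∃ 𝔠 : AlphaConsts L (suGroupModel 2).N, 𝔠.b₀ = b₀ ∧ 𝔠.p₀ = p₀ ∧ 𝔠.B₃ = B ∧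
            4 * 𝔠.B₃ * (L : ℝ) ^ 2 * avgWindowFactor L ≤ 𝔠.C68 ∧
            Real.exp (𝔠.p₀ - 1) ≤ 3 * C0 3 * 𝔠.C68 * (𝔠.b₀ * Q0 𝔠.p₀) ∧
            (𝔠.b₀ * Q0 𝔠.p₀) * (2 * (L : ℝ) ^ 2 * avgWindowFactor L) ^ 2 ≤ 3 * C0 3 * 𝔠.C68 * a₁ ^ 2 ∧
            7 * L + 3 ≤ 𝔠.M₁ ∧
            ∀ (F : T3Family) (hF : F.L = L),
              (∀ (γ : ℝ) (hγ : 0 < γ) (hγ1 : γ ≤ (min (hF ▸ 𝔠).gamma0 1) ^ 2) (K : ℕ),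
                (∃ Ut : (k : ℕ) → GaugeField (F.P K) k (Matrix.specialUnitaryGroup (Fin 2) ℂ) →
                    GaugeField (F.P K) 0 (Matrix.specialUnitaryGroup (Fin 2) ℂ),
                  AlphaInputsT3AC.TrivMinimiserRowsT3 F (hF ▸ 𝔠) γ hγ hγ1 a₀ a₁ K Ut) →
                ∃ Ut : (k : ℕ) → GaugeField (F.P K) k (Matrix.specialUnitaryGroup (Fin 2) ℂ) →
                    GaugeField (F.P K) 0 (Matrix.specialUnitaryGroup (Fin 2) ℂ),
                  AlphaInputsT3AC.TrivMinimiserRowsT3 F (hF ▸ 𝔠) γ hγ hγ1 a₀ a₁ K Ut ∧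
                    AlphaInputsT3AC.DataRowsT3XChi F (hF ▸ 𝔠) γ hγ hγ1 K Ut)) :
    Summit.QuantumFields.YangMills.Theses.UnitScaleTilt.HistoryTailL := by
  refine HistoryTailLaneTailChi.historyTailL_of_pinnedPartsRecFLChi fun L hLo hL => ?_
  obtain ⟨a₀, a₁, B₃, ha₀, ha₁, hB₃, hT, -⟩ := hT8 L hLo hL
  obtain ⟨B_FL, A_FL, hA_FL, hfl⟩ := hFL L hLo hL
  obtain ⟨B₀, A₀, A₁, hA₀, hA₁, ho⟩ := hO L hLo hL
  exact pinnedPartsT3ACRecFLChi_of_thm1_fineLifts_dataRows hL ⟨a₀, a₁, B₃, ha₀, ha₁, hB₃, hT⟩ hA_FL hfl hA₀ hA₁ ho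

/-- ★★★ **`HistoryTailL` ⇐ ⟨v5kC's T8 TEXT⟩ ∧ (∀ odd `L > 1`, ★w1's `hLift` AS A PER-RECORD KINEMATIC THEOREM at some `B_L ≥ 1`) ∧ (∀ odd `L > 1`, THE (O″χ) ROWS)** — DEPMAP v3.5's
three arrows for 19936 in one statement: (T) ⇐ 19200 (compose ★r1 g5's `thm1In8GlobalMin_of_v8Leaves(4)`∕`_v9Leaves`), (FL) ⇐ `hLift` ⇐ Newton on the (LL) engine, (O″χ) ⇐ NODE O.
[cite: Balaban1985UV3, (5) p.256, (47) p.267, (71) p.273 and Thm 2 p.272; Balaban1985Variational, Thm 1 (8) p.279, (11)–(14) pp.279–280 and Prop 8 p.304; King1986, (3.12) p.657] -/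
theorem historyTailL_of_thm1In8_regionalLifts_dataRows_allL
    (hT8 : ∀ L : ℕ, Odd L → 1 < L → ∃ a₀ a₁ B₃ : ℝ, 0 < a₀ ∧ 0 < a₁ ∧ 0 < B₃ ∧
      Thm1GlobalMinAt L a₀ a₁ B₃ ∧ MinimisersIn8At L a₀ a₁ B₃)
    (hLift : ∀ L : ℕ, Odd L → 1 < L → ∃ (B_L A_FL : ℝ), 1 ≤ B_L ∧ 0 < A_FL ∧
      ∀ (𝔠 : AlphaConsts L (suGroupModel 2).N) (a₁ : ℝ), B_L * (L : ℝ) ^ 2 ≤ 𝔠.B₃ → 1 ≤ 2 * 𝔠.B₃ → 0 < a₁ → a₁ ≤ A_FL →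
      (143 * ((((3 + 4 : ℕ) : ℝ)) ^ 2 / 4) ^ 2) * (2 * (𝔠.B₃ * a₁)) ≤ 1 / 3 →
      2 * (2 * (𝔠.B₃ * a₁)) ≤ 2 * deltaSU (Fin 2) / (((3 + 4) * L : ℕ) : ℝ) ^ 2 →
      4 * 𝔠.B₃ * (L : ℝ) ^ 2 * avgWindowFactor L ≤ 𝔠.C68 →
      Real.exp (𝔠.p₀ - 1) ≤ 3 * C0 3 * 𝔠.C68 * (𝔠.b₀ * Q0 𝔠.p₀) →
      (𝔠.b₀ * Q0 𝔠.p₀) * (2 * (L : ℝ) ^ 2 * avgWindowFactor L) ^ 2 ≤ 3 * C0 3 * 𝔠.C68 * a₁ ^ 2 →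
      7 * L + 3 ≤ 𝔠.M₁ →
      ∀ (F : T3Family) (hF : F.L = L) (γ : ℝ) (hγ : 0 < γ) (hγ1 : γ ≤ (min (hF ▸ 𝔠).gamma0 1) ^ 2) (K : ℕ),
        ∀ (k : ℕ), k + 1 ≤ K → ∀ (h : Hist (F.P K) (k + 1)),
                  Hist.Admissible (hF ▸ 𝔠).lane.carrier.M₁ (rcolOf (T3Scales F γ hγ (hγ1.trans (sq_min_one_le _ (hF ▸ 𝔠).gamma0_pos)) K) (hF ▸ 𝔠).lane.carrier) (k + 1) h →
                  h ≠ Hist.triv (F.P K) (k + 1) → ∀ (V : GaugeField (F.P K) k (Matrix.specialUnitaryGroup (Fin 2) ℂ)),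
                    (∀ Q : Plaq (F.P K) k, Q ∈ plaqsIn k (Omega (hF ▸ 𝔠).lane.carrier.M₁
                        (rcolOf (T3Scales F γ hγ (hγ1.trans (sq_min_one_le _ (hF ▸ 𝔠).gamma0_pos)) K) (hF ▸ 𝔠).lane.carrier) (k + 1) h (k + 1)) →
                      GaugeGroup.dist1 (GaugeField.plaqHol V Q) ≤ 2 * (F.L : ℝ) ^ 2 * avgWindowFactor F.L * θBal F.L γ (hF ▸ 𝔠).b₀ (hF ▸ 𝔠).p₀ (K - k)) →
                    ∃ U : GaugeField (F.P K) 0 (Matrix.specialUnitaryGroup (Fin 2) ℂ),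
                      (∀ b : PBond (F.P K) k, b ∈ bondsIn k (Omega (hF ▸ 𝔠).lane.carrier.M₁
                          (rcolOf (T3Scales F γ hγ (hγ1.trans (sq_min_one_le _ (hF ▸ 𝔠).gamma0_pos)) K) (hF ▸ 𝔠).lane.carrier) (k + 1) h (k + 1)) →
                        Averaging.iter (fun i => BlockAveraging.blockAvg (P := F.P K) (j := i) ℰp) k U b = V b) ∧
                      ∀ q : Plaq (F.P K) 0, q ∈ plaqsIn 0 (Omega (hF ▸ 𝔠).lane.carrier.M₁
                          (rcolOf (T3Scales F γ hγ (hγ1.trans (sq_min_one_le _ (hF ▸ 𝔠).gamma0_pos)) K) (hF ▸ 𝔠).lane.carrier) (k + 1) h (k + 1)) →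
                        GaugeGroup.dist1 (GaugeField.plaqHol U q) <
                          B_L * (2 * (F.L : ℝ) ^ 2 * avgWindowFactor F.L * θBal F.L γ (hF ▸ 𝔠).b₀ (hF ▸ 𝔠).p₀ (K - k)) * (((F.L : ℝ) ^ k)⁻¹) ^ 2)
    (hO : ∀ L : ℕ, Odd L → 1 < L → ∃ (B₀ A₀ A₁ : ℝ), 0 < A₀ ∧ 0 < A₁ ∧
      ∀ (B a₀ a₁ : ℝ), B₀ ≤ B → 1 ≤ 2 * B → 0 < a₀ → a₀ ≤ A₀ → 0 < a₁ → a₁ ≤ A₁ → B * a₁ ≤ a₀ →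
        (143 * ((((3 + 4 : ℕ) : ℝ)) ^ 2 / 4) ^ 2) * (2 * (B * a₁)) ≤ 1 / 3 →
        2 * (2 * (B * a₁)) ≤ 2 * deltaSU (Fin 2) / (((3 + 4) * L : ℕ) : ℝ) ^ 2 →
        Thm1GlobalMinAt L a₀ a₁ B →
        ∃ (b₁ p₁ : ℝ), ∀ (b₀ p₀ : ℝ), b₁ ≤ b₀ → p₁ ≤ p₀ →
          ∃ 𝔠 : AlphaConsts L (suGroupModel 2).N, 𝔠.b₀ = b₀ ∧ 𝔠.p₀ = p₀ ∧ 𝔠.B₃ = B ∧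
            4 * 𝔠.B₃ * (L : ℝ) ^ 2 * avgWindowFactor L ≤ 𝔠.C68 ∧
            Real.exp (𝔠.p₀ - 1) ≤ 3 * C0 3 * 𝔠.C68 * (𝔠.b₀ * Q0 𝔠.p₀) ∧
            (𝔠.b₀ * Q0 𝔠.p₀) * (2 * (L : ℝ) ^ 2 * avgWindowFactor L) ^ 2 ≤ 3 * C0 3 * 𝔠.C68 * a₁ ^ 2 ∧
            7 * L + 3 ≤ 𝔠.M₁ ∧
            ∀ (F : T3Family) (hF : F.L = L),
              (∀ (γ : ℝ) (hγ : 0 < γ) (hγ1 : γ ≤ (min (hF ▸ 𝔠).gamma0 1) ^ 2) (K : ℕ),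
                (∃ Ut : (k : ℕ) → GaugeField (F.P K) k (Matrix.specialUnitaryGroup (Fin 2) ℂ) →
                    GaugeField (F.P K) 0 (Matrix.specialUnitaryGroup (Fin 2) ℂ),
                  AlphaInputsT3AC.TrivMinimiserRowsT3 F (hF ▸ 𝔠) γ hγ hγ1 a₀ a₁ K Ut) →
                ∃ Ut : (k : ℕ) → GaugeField (F.P K) k (Matrix.specialUnitaryGroup (Fin 2) ℂ) →
                    GaugeField (F.P K) 0 (Matrix.specialUnitaryGroup (Fin 2) ℂ),
                  AlphaInputsT3AC.TrivMinimiserRowsT3 F (hF ▸ 𝔠) γ hγ hγ1 a₀ a₁ K Ut ∧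
                    AlphaInputsT3AC.DataRowsT3XChi F (hF ▸ 𝔠) γ hγ hγ1 K Ut)) :
    Summit.QuantumFields.YangMills.Theses.UnitScaleTilt.HistoryTailL := by
  refine HistoryTailLaneTailChi.historyTailL_of_pinnedPartsRecFLChi fun L hLo hL => ?_
  obtain ⟨a₀, a₁, B₃, ha₀, ha₁, hB₃, hT, -⟩ := hT8 L hLo hL
  obtain ⟨B_L, A_FL, hBL, hA_FL, hl⟩ := hLift L hLo hL
  obtain ⟨B₀, A₀, A₁, hA₀, hA₁, ho⟩ := hO L hLo hL
  exact pinnedPartsT3ACRecFLChi_of_thm1_regionalLifts_dataRows hL ⟨a₀, a₁, B₃, ha₀, ha₁, hB₃, hT⟩ hBL hA_FL hl hA₀ hA₁ ho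

end Summit.QuantumFields.YangMills.Theorems.HistoryTailOneSupplier

end
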